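/-
Copyright (c) 2026 the pub-hodgecm-mathlib formalisation cell (harness21).  Prover seat hodgecm-mathlib-K2E4-p10 (g11), Track B «K2-LIT»,
#184♮ = hLiu418 = `stmt-HodgeConjecture-24832`; socket #41, KIND 1 — (K1a-T)(L2-dock)(v-β) THE PREFACTOR DICTIONARY `hP` OF ★ p864498
`hAcb_of_archLetters` FROM THE CORNER READING (K1a desk K2Liu-p01 (g11) WORD #15 (2), 2026-09-05T02:48:02Z; SPEC = K2Liu-p03 (g8) census
02:41:48Z + ★ (v-α) p864728 product letters; the `Sz` bytes of LH7-p05 (g3)'s (G-b) SIG 02:41:10Z).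
THEOREMS ONLY (no `def`, no `instance`, no notation, no named-fact hypothesis, no `sorry`).
-/
import Summits.HodgeConjecture.HodgeConjecture.Theorems.K2LiuKindOneSingularGaussianDictionary   -- ★ p864639 (vi) (K2Liu-p03): the corner-reading frame (`hnorm`, `hpres`, readings (b)(c)); ★ `gramRL_apply_same_ne_zero`
import Summits.HodgeConjecture.HodgeConjecture.Theorems.K2LiuKindOneSingularArchProducts        -- ★ p864728 (v-α) (K2Liu-p03): `prod_inv_apply_le_pow_of_isIntegral`, `prod_sum_sq_normalisedRow_le`
import Summits.HodgeConjecture.HodgeConjecture.Theorems.K2LiuCornerScalarPoleCount             -- ★ p864275 (C-d-i) (LH7-p05): `exists_cornerScalar_den_pole_count` (`(D d₀)·σc` is `ℤ`-integral)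
import Summits.HodgeConjecture.HodgeConjecture.Theorems.K2LiuKindOneLineTranslateHeight         -- ★ `exists_leviRow_translate_height_le` (the translate chain `‖Λ(γ[w])·h‖ ≤ C(D(1+τ))^k‖h‖^{k'}`)
import Summits.HodgeConjecture.HodgeConjecture.Theorems.K2LiuRowSectionHeightLeVecHeight        -- ★ (B-ii) `exists_adelicHeightGL_rowSection_le`
import Summits.HodgeConjecture.HodgeConjecture.Theorems.K2LiuVecHeightVsMulHeight              -- ★ p863361 (B-i) `exists_vecHeight_principalVec_le_mulHeight_pow`
import Summits.HodgeConjecture.HodgeConjecture.Theorems.K2LiuLeviHomHeightBound                -- ★ (B-iii) `exists_adelicHeightGL_leviHom_le_sq`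
import Summits.HodgeConjecture.HodgeConjecture.Theorems.K2LiuWhittakerWeightedGrowthInstance   -- ★ `exists_pos_le_adelicHeightGL` (the height floor `‖h‖ ≥ m > 0`)
import HarnessLib

/-!
# Crux `HLiu418`, socket #41, KIND 1 a♮ — (K1a-T)(L2-dock)(v-β) `K2LiuKindOneSingularPrefactorDictionary`: `∏_w Sz_w ≤ C₁·‖h‖^{a₁}·(1+τa X)^{N₁'}·d^{Nd₁'}`

Cell `hodgecm-mathlib`, crux item hLiu418 = `stmt-HodgeConjecture-24832` (helper lane `--supports … --as helper`, count-neutral), route of record `HCCMUnconditional`;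
squad K2 ∕ K2Liu, road `K2_Liu`, socket #41, KIND 1, block K1-a♮.  CONSUMER: ★ p864498 `K2LiuKindOneSingularArchDecayOfRecord.hAcb_of_archLetters`, slot (v)
`hP : ∀ X h, rank-one → ∀ d ≥ 1, d·X integral → ∏_{w∈Tinf} Pw X h w ≤ C₁·‖h‖^{a₁}·(1+τa X)^{N₁'}·d^{Nd₁'}` at the ARCH-CONT per-place size
`Pw X h w ≤ Sz_w := (((1 + p_w)(1 + p_w⁻¹))·((1 + t_w)(1 + t_w⁻¹)))·(1 + R_w)` ((G-b) `norm_continuedFormula_le`'s polynomial factor, LH7-p05 (g3)).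
THE MATHEMATICS ([KudlaRallis1994, §2], [Shimura1997, §18.4]; heights [BombieriGubler2006, §1.5]; product formula [NeukirchANT1999, III §1]).  No factor of `Sz_w` is bounded at ONE
complex place uniformly in the rank-one index `X` (`t_w⁻¹ = (κ_w·w(σc X))⁻¹`, `p_w ≍ ‖ι_w γ̂₁‖²`), but the PRODUCTS over the complex places are lattice-controlled.  Per place, with
the pivot `i` of the normalised row `γ̂₁ = w_i⁻¹·w` (`γ̂_{1i} = 1`, so `S_w := Σ_k ‖ι_w γ̂_{1k}‖² ≥ 1`) and the height floor `‖h‖ ≥ m`: `1 + p_w ≤ (m^{−bP} + CP)·‖h‖^{bP}·S_w` ((b↑));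
`1 + p_w⁻¹ ≤ (m^{−aV} + (cp·cV)⁻¹)·‖h‖^{aV}` ((b) + (c), `S_w ≥ 1`); `1 + t_w ≤ (1 + κ_w·Kt)·(1 + τa X)` ((a=), `w(σc X) = (w(t_i)∕w(t₁))·w(X_ii) ≤ Kt·τa X` by (g));
`1 + t_w⁻¹ = (1 + t_w)·κ_w⁻¹·w(σc X)⁻¹`; `1 + R_w ≤ (m^{−k'aR} + CR·Ctr^{aR})·(d(1+τa X))^{ktr·aR}·‖h‖^{k'aR}` ((r) + the translate chain `‖gc X·h‖ ≤ Ctr·(d(1+τa X))^{ktr}·‖h‖^{k'}`,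
★ `exists_leviRow_translate_height_le` over ★ (B-i)(B-ii)(B-iii) as in ★ p864306).  Multiplying over `w ∣ ∞`, the two global products are ★ (v-α)'s letters:
`∏_w S_w ≤ 2^{#w}·(d(1+τa X))^{[L:ℚ]}` (`prod_sum_sq_normalisedRow_le`) and `∏_w w(σc X)⁻¹ ≤ (d·d₀)^{[L:ℚ]}` (`prod_inv_apply_le_pow_of_isIntegral`, `(d d₀)·σc X` integral by ★ (C-d-i)).
* `sizeFactor_le` — the per-place real inequality `Sz ≤ F₁·F₂·F₃·F₄·F₅` from the readings (pure real algebra);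
* **`hP_of_cornerReading`** — the letter: `∃ N₁' Nd₁' C₁ a₁, 0 ≤ C₁ ∧ 0 ≤ a₁ ∧ ∀ X h, rank-one → ∀ d ≥ 1, d·X integral → ∏_{w∈Tinf} Pw X h w ≤ C₁·‖h‖^{a₁}·(1+τa X)^{N₁'}·d^{Nd₁'}`.
HONEST LABEL.  Count-neutral helper (bookkeeping over named letters; the readings (a=)(b)(b↑)(c)(r)(Sz) are the (o1)-face ∕ (m2) ∕ ARCH-CONT hands' letters, taken BY VALUE);
it closes no socket: `HC_CM` is proved only modulo the 7 printed citations (2 remaining named inputs: hLiu418 = `stmt-HodgeConjecture-24832`, h413 = `stmt-HodgeConjecture-24833`)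
until rung 0 closes.

## References
* [KudlaRallis1994] S. Kudla, S. Rallis, *A regularized Siegel–Weil formula: the first term identity*, Ann. of Math. 140 (1994): §2 (2.10)–(2.12).
* [Shimura1997] G. Shimura, *Euler Products and Eisenstein Series*, CBMS 93 (1997): §18.1, §18.4 Prop. 18.14.
* [BombieriGubler2006] E. Bombieri, W. Gubler, *Heights in Diophantine Geometry* (2006): §1.5.
* [NeukirchANT1999] J. Neukirch, *Algebraic Number Theory* (1999): Ch. III §1 (product formula).
* [BorelJacquet1979] A. Borel, H. Jacquet, *Automorphic forms and automorphic representations*, PSPM 33.1 (1979): §1.2.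
* [MoeglinWaldspurger1995] C. Mœglin, J.-L. Waldspurger, *Spectral Decomposition and Eisenstein Series* (1995): I.2.2, II.1.7.
-/

set_option autoImplicit false
-- the mandated namespace repeats the single-problem summit's segment (`HodgeConjecture.HodgeConjecture`)
set_option linter.dupNamespace false

noncomputable section

open scoped Matrix NNReal MatrixGroups
open NumberField NumberField.InfinitePlace IsDedekindDomain Height

namespace Summit.HodgeConjecture.HodgeConjecture.Cruxes.HLiu418.K2LiuKindOneSingularPrefactorDictionary

open Literature.NumberTheory.Automorphic Literature.NumberTheory.Automorphic.UnitaryGroup Literature.NumberTheory.GaloisRepresentations Literature.NumberTheory.K2Lit.SiegelDoubled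
open Literature.NumberTheory.GelbartRogawski1991 Literature.NumberTheory.GelbartRogawski1991.GRConstruction Literature.NumberTheory.GelbartRogawski1991.AdaptedBlocks
open Literature.NumberTheory.GelbartRogawski1991.UnitaryDualPair
open Summit.HodgeConjecture.HodgeConjecture.Cruxes.HLiu418.K2LiuSiegelUnipotentLocalDefs Summit.HodgeConjecture.HodgeConjecture.Cruxes.HLiu418.K2LiuSiegelUnipotentSplitDefs
open Summit.HodgeConjecture.HodgeConjecture.Cruxes.HLiu418.K2LiuSiegelUnipotentSplitAtDefs Summit.HodgeConjecture.HodgeConjecture.Cruxes.HLiu418.K2LiuSiegelUnipotentFourierDefs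
open Summit.HodgeConjecture.HodgeConjecture.Cruxes.HLiu418.K2LiuKindOneSingularArchProducts (prod_inv_apply_le_pow_of_isIntegral prod_sum_sq_normalisedRow_le)

section Real

/-- **THE PER-PLACE SIZE INEQUALITY** (pure real algebra).  With a height `H ≥ m > 0`, a row size `S ≥ 1`, a Gaussian parameter `p` read from below and above
(`cp·(cV·H^{−aV}·S) ≤ p ≤ CP·H^{bP}·S`), a corner size `t = κ·s` (`κ, s > 0`, `s ≤ Kt·τ`) and an entry bound `0 ≤ R ≤ CR·B^{aR}` with `B ≤ Ctr·Q·H^{k'}` (`Q ≥ 1`):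
`(((1+p)(1+p⁻¹))((1+t)(1+t⁻¹)))(1+R) ≤ ((m⁻¹^{bP}+CP)H^{bP}S · (m⁻¹^{aV}+(cp cV)⁻¹)H^{aV}) · (F₃ · (F₃ · (κ⁻¹ s⁻¹))) · ((m⁻¹^{k'aR}+CR·Ctr^{aR})·Q^{aR}·H^{k'aR})`,
`F₃ := (1 + κ·Kt)(1 + τ)`. [folklore] -/
theorem sizeFactor_le {p t R s S H m κ Kt τ Q B cp cV aV CP bP CR Ctr : ℝ} {aR k' : ℕ} (hm : 0 < m) (hmH : m ≤ H) (hS1 : 1 ≤ S)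
    (hcp : 0 < cp) (hcV : 0 < cV) (haV : 0 ≤ aV) (hbP : 0 ≤ bP) (hp_lo : cp * (cV * H ^ (-aV) * S) ≤ p) (hp_hi : p ≤ CP * H ^ bP * S)
    (hκ : 0 < κ) (hs : 0 < s) (ht : t = κ * s) (hKt : 0 ≤ Kt) (hτ : 0 ≤ τ) (hs_hi : s ≤ Kt * τ)
    (hR0 : 0 ≤ R) (hCR : 0 ≤ CR) (hR : R ≤ CR * B ^ aR) (hB0 : 0 ≤ B) (hQ : 1 ≤ Q) (hB : B ≤ Ctr * Q * H ^ k') :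
    (((1 + p) * (1 + p⁻¹)) * ((1 + t) * (1 + t⁻¹))) * (1 + R) ≤
      ((((m⁻¹ ^ bP + CP) * H ^ bP * S) * ((m⁻¹ ^ aV + (cp * cV)⁻¹) * H ^ aV)) *
        (((1 + κ * Kt) * (1 + τ)) * (((1 + κ * Kt) * (1 + τ)) * (κ⁻¹ * s⁻¹)))) *
      ((m⁻¹ ^ (k' * aR) + CR * Ctr ^ aR) * Q ^ aR * H ^ (k' * aR)) := by
  have hH0 : 0 < H := hm.trans_le hmH
  have hHm1 : 1 ≤ m⁻¹ * H := by rw [le_inv_mul_iff₀ hm, mul_one]; exact hmH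
  have hfl : ∀ b : ℝ, 0 ≤ b → 1 ≤ m⁻¹ ^ b * H ^ b := fun b hb => by rw [← Real.mul_rpow (inv_pos.2 hm).le hH0.le]; exact Real.one_le_rpow hHm1 hb
  have hflN : ∀ b : ℕ, 1 ≤ m⁻¹ ^ b * H ^ b := fun b => by rw [← mul_pow]; exact one_le_pow₀ hHm1
  have hcVH : 0 ≤ cV * H ^ (-aV) := mul_nonneg hcV.le (Real.rpow_nonneg hH0.le _)
  have hlo0 : 0 < cp * cV * H ^ (-aV) := mul_pos (mul_pos hcp hcV) (Real.rpow_pos_of_pos hH0 _)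
  have hlo : cp * cV * H ^ (-aV) ≤ p :=
    calc cp * cV * H ^ (-aV) = cp * (cV * H ^ (-aV) * 1) := by ring
      _ ≤ cp * (cV * H ^ (-aV) * S) := mul_le_mul_of_nonneg_left (mul_le_mul_of_nonneg_left hS1 hcVH) hcp.le
      _ ≤ p := hp_lo
  have hp0 : 0 < p := hlo0.trans_le hlo
  have h1 : 1 + p ≤ (m⁻¹ ^ bP + CP) * H ^ bP * S :=
    calc 1 + p ≤ m⁻¹ ^ bP * H ^ bP * S + CP * H ^ bP * S := add_le_add (one_le_mul_of_one_le_of_one_le (hfl bP hbP) hS1) hp_hi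
      _ = (m⁻¹ ^ bP + CP) * H ^ bP * S := by ring
  have h2 : 1 + p⁻¹ ≤ (m⁻¹ ^ aV + (cp * cV)⁻¹) * H ^ aV := by
    have hpinv : p⁻¹ ≤ (cp * cV)⁻¹ * H ^ aV :=
      calc p⁻¹ ≤ (cp * cV * H ^ (-aV))⁻¹ := inv_anti₀ hlo0 hlo
        _ = (cp * cV)⁻¹ * H ^ aV := by rw [mul_inv, Real.rpow_neg hH0.le, inv_inv]
    calc 1 + p⁻¹ ≤ m⁻¹ ^ aV * H ^ aV + (cp * cV)⁻¹ * H ^ aV := add_le_add (hfl aV haV) hpinv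
      _ = (m⁻¹ ^ aV + (cp * cV)⁻¹) * H ^ aV := by ring
  have ht0 : 0 < t := by rw [ht]; exact mul_pos hκ hs
  have h3 : 1 + t ≤ (1 + κ * Kt) * (1 + τ) := by
    have hks : κ * s ≤ κ * (Kt * τ) := mul_le_mul_of_nonneg_left hs_hi hκ.le
    have key : (1 + κ * Kt) * (1 + τ) = 1 + κ * (Kt * τ) + (τ + κ * Kt) := by ring
    rw [ht, key]
    linarith [mul_nonneg hκ.le hKt]
  have h4 : 1 + t⁻¹ ≤ (1 + κ * Kt) * (1 + τ) * (κ⁻¹ * s⁻¹) := by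
    have heq : 1 + t⁻¹ = (1 + t) * (κ⁻¹ * s⁻¹) := by rw [← mul_inv, ← ht, add_mul, one_mul, mul_inv_cancel₀ ht0.ne', add_comm]
    rw [heq]
    exact mul_le_mul_of_nonneg_right h3 (mul_nonneg (inv_pos.2 hκ).le (inv_pos.2 hs).le)
  have h5 : 1 + R ≤ (m⁻¹ ^ (k' * aR) + CR * Ctr ^ aR) * Q ^ aR * H ^ (k' * aR) := by
    have hRle : R ≤ CR * Ctr ^ aR * Q ^ aR * H ^ (k' * aR) :=
      calc R ≤ CR * B ^ aR := hR
        _ ≤ CR * (Ctr * Q * H ^ k') ^ aR := mul_le_mul_of_nonneg_left (pow_le_pow_left₀ hB0 hB aR) hCR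
        _ = CR * Ctr ^ aR * Q ^ aR * H ^ (k' * aR) := by rw [mul_pow, mul_pow, ← pow_mul]; ring
    have hone : 1 ≤ m⁻¹ ^ (k' * aR) * Q ^ aR * H ^ (k' * aR) :=
      calc (1 : ℝ) ≤ m⁻¹ ^ (k' * aR) * H ^ (k' * aR) := hflN _
        _ = m⁻¹ ^ (k' * aR) * 1 * H ^ (k' * aR) := by rw [mul_one]
        _ ≤ m⁻¹ ^ (k' * aR) * Q ^ aR * H ^ (k' * aR) :=
            mul_le_mul_of_nonneg_right (mul_le_mul_of_nonneg_left (one_le_pow₀ hQ) (pow_nonneg (inv_pos.2 hm).le _)) (pow_nonneg hH0.le _)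
    calc 1 + R ≤ m⁻¹ ^ (k' * aR) * Q ^ aR * H ^ (k' * aR) + CR * Ctr ^ aR * Q ^ aR * H ^ (k' * aR) := add_le_add hone hRle
      _ = (m⁻¹ ^ (k' * aR) + CR * Ctr ^ aR) * Q ^ aR * H ^ (k' * aR) := by ring
  have h1' : 0 ≤ 1 + p := by linarith
  have h2' : 0 ≤ 1 + p⁻¹ := add_nonneg zero_le_one (inv_pos.2 hp0).le
  have h3' : 0 ≤ 1 + t := by linarith
  have h4' : 0 ≤ 1 + t⁻¹ := add_nonneg zero_le_one (inv_pos.2 ht0).le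
  have hpp : (1 + p) * (1 + p⁻¹) ≤ ((m⁻¹ ^ bP + CP) * H ^ bP * S) * ((m⁻¹ ^ aV + (cp * cV)⁻¹) * H ^ aV) := mul_le_mul h1 h2 h2' (h1'.trans h1)
  have htt : (1 + t) * (1 + t⁻¹) ≤ ((1 + κ * Kt) * (1 + τ)) * (((1 + κ * Kt) * (1 + τ)) * (κ⁻¹ * s⁻¹)) := mul_le_mul h3 h4 h4' (h3'.trans h3)
  exact mul_le_mul (mul_le_mul hpp htt (mul_nonneg h3' h4') ((mul_nonneg h1' h2').trans hpp)) h5 (by linarith)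
    ((mul_nonneg (mul_nonneg h1' h2') (mul_nonneg h3' h4')).trans (mul_le_mul hpp htt (mul_nonneg h3' h4') ((mul_nonneg h1' h2').trans hpp)))

end Real

variable (L : Type) [Field L] [NumberField L] [IsCMField L]

section Dictionary

variable {N M : ℕ} (e : Fin N × Fin M ≃ Fin 2) (dV : Fin N → L) (hdV : ∀ i, IsCMField.complexConj L (dV i) = dV i)
  (dW : Fin M → L) (hdW : ∀ i, IsCMField.complexConj L (dW i) = dW i)

open Classical in -- the archimedean size `‖(ι_∞ X_ab)_ab‖` is read with the consumers' instances (★ p863404 ∕ ★ p864122 ∕ ★ p864498: `open Classical in`)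
/-- **(K1a-T)(L2-dock)(v-β) THE PREFACTOR DICTIONARY FROM THE CORNER READING.**  INPUTS (by value): `dV dW ≠ 0`; the Levi chart `Λ` with ★ α3-2's block law `hΛ` and a
NORMALISED row section `γ` (`hnorm` = ★ `exists_normalised_rowSection`'s entry letter) — the binders of ★ p864306 VERBATIM; the complex places `Tinf` with `hall`; ★ (A)'s
witnesses `σc gc u w hw` with the letters (f) `hgc`, (g) `hpres`; the ARCH-CONT per-place variables `tw pw Rw` and the size `Pw`, the half-space imaginary parts `V`, BY VALUE,
with SIX letters — (a=) `htw_eq : tw X w' = κ w'·w'(σc X)` (`0 < κ`), (b) `hpw` the lower translate reading `cp·Re⟨ι_{w'}γ̂₁, V w' h·ι_{w'}γ̂₁⟩ ≤ pw X h w'` and (c) `hV` the λ_min floor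
`cV·‖h‖^{−aV}·Σ‖v_k‖² ≤ Re⟨v, V w' h v⟩` (both VERBATIM from ★ p864639), (b↑) `hpw_le : pw X h w' ≤ CP·‖h‖^{bP}·Σ_k ‖ι_{w'}γ̂_{1k}‖²`, (r) `hRw : 0 ≤ Rw X h w' ≤ CR·‖gc X·h‖^{aR}`,
(Sz) `hPw : Pw X h w' ≤ (((1 + pw)(1 + pw⁻¹))((1 + tw)(1 + tw⁻¹)))(1 + Rw)` (the (G-b) polynomial factor), plus ★ p864498's `hP1 : 1 ≤ Pw`; the archimedean size `τa` (`hτa`).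
OUTPUT = ★ p864498's slot (v): `∃ N₁' Nd₁' C₁ a₁, 0 ≤ C₁ ∧ 0 ≤ a₁ ∧ ∀ X h, ↑X ≠ 0 → det ↑X = 0 → ∀ d ≥ 1, (∀ i j, IsIntegral ℤ (d·X i j)) →
∏_{w∈Tinf} Pw X h w ≤ C₁·‖h‖^{a₁}·(1 + τa X)^{N₁'}·d^{Nd₁'}`. [cite: KudlaRallis1994, §2 (2.10)–(2.12)] [cite: Shimura1997, §18.4 Prop. 18.14] [cite: BombieriGubler2006, §1.5]
[cite: NeukirchANT1999, Ch. III §1] [cite: BorelJacquet1979, §1.2] [cite: MoeglinWaldspurger1995, I.2.2, II.1.7] -/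
theorem hP_of_cornerReading (hdV0 : ∀ i, dV i ≠ 0) (hdW0 : ∀ i, dW i ≠ 0)
    -- the Levi chart with its block law and a NORMALISED row section (★ p864306's binders VERBATIM)
    (Λ : GL (Fin 2) (AdeleRing (𝓞 L) L) →* HA L e dV hdV dW hdW)
    (hΛ : ∀ g : GL (Fin 2) (AdeleRing (𝓞 L) L), blk L e dV hdV dW hdW (Λ g) =
      cayR (AdeleRing (𝓞 L) L) (Fin 2) * Matrix.fromBlocks (g : Matrix (Fin 2) (Fin 2) (AdeleRing (𝓞 L) L)) 0 0
        (((gramR L e dV hdV dW hdW).map ((algebraMap L (AdeleRing (𝓞 L) L)).comp (algebraMap (Fp L) L)))⁻¹ *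
          (((g⁻¹ : GL (Fin 2) (AdeleRing (𝓞 L) L)) : Matrix (Fin 2) (Fin 2) (AdeleRing (𝓞 L) L)).map (conjAdele (Fp L) L (IsCMField.complexConj L)))ᵀ *
          (gramR L e dV hdV dW hdW).map ((algebraMap L (AdeleRing (𝓞 L) L)).comp (algebraMap (Fp L) L))) * cayRinv (AdeleRing (𝓞 L) L) (Fin 2))
    (γ : Projectivization L (Fin 2 → L) → GL (Fin 2) L)
    (hnorm : ∀ (w : Fin 2 → L) (hw : w ≠ 0), ∃ i : Fin 2, w i ≠ 0 ∧ (γ (Projectivization.mk L w hw) : Matrix (Fin 2) (Fin 2) L) 1 = (w i)⁻¹ • w ∧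
      ∀ a b : Fin 2,
        (∃ k : Fin 2, (γ (Projectivization.mk L w hw) : Matrix (Fin 2) (Fin 2) L) a b = 0 ∨ (γ (Projectivization.mk L w hw) : Matrix (Fin 2) (Fin 2) L) a b = 1 ∨
          (γ (Projectivization.mk L w hw) : Matrix (Fin 2) (Fin 2) L) a b = (w i)⁻¹ * w k ∨ (γ (Projectivization.mk L w hw) : Matrix (Fin 2) (Fin 2) L) a b = -((w i)⁻¹ * w k)) ∧
        (∃ k : Fin 2, (((γ (Projectivization.mk L w hw))⁻¹ : GL (Fin 2) L) : Matrix (Fin 2) (Fin 2) L) a b = 0 ∨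
          (((γ (Projectivization.mk L w hw))⁻¹ : GL (Fin 2) L) : Matrix (Fin 2) (Fin 2) L) a b = 1 ∨
          (((γ (Projectivization.mk L w hw))⁻¹ : GL (Fin 2) L) : Matrix (Fin 2) (Fin 2) L) a b = (w i)⁻¹ * w k ∨
          (((γ (Projectivization.mk L w hw))⁻¹ : GL (Fin 2) L) : Matrix (Fin 2) (Fin 2) L) a b = -((w i)⁻¹ * w k)))
    -- the complex places (all of them); ★ (A)'s witnesses with the letters (f) `hgc`, (g) `hpres`, BY VALUE
    (Tinf : Finset (InfinitePlace L)) (hall : ∀ w' : InfinitePlace L, w' ∈ Tinf)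
    (σc : skewMatrices ((IsCMField.complexConj L : L ≃ₐ[Fp L] L) : L →+* L) ((gramR L e dV hdV dW hdW).map (algebraMap (Fp L) L)) → L)
    (gc : skewMatrices ((IsCMField.complexConj L : L ≃ₐ[Fp L] L) : L →+* L) ((gramR L e dV hdV dW hdW).map (algebraMap (Fp L) L)) → HA L e dV hdV dW hdW)
    (u w : skewMatrices ((IsCMField.complexConj L : L ≃ₐ[Fp L] L) : L →+* L) ((gramR L e dV hdV dW hdW).map (algebraMap (Fp L) L)) → Fin 2 → L) (hw : ∀ S, w S ≠ 0)
    (hgc : ∀ S, gc S = Λ (Matrix.GeneralLinearGroup.map (algebraMap L (AdeleRing (𝓞 L) L)) (γ (Projectivization.mk L (w S) (hw S)))))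
    (hpres : ∀ S : skewMatrices ((IsCMField.complexConj L : L ≃ₐ[Fp L] L) : L →+* L) ((gramR L e dV hdV dW hdW).map (algebraMap (Fp L) L)),
      (S : Matrix (Fin 2) (Fin 2) L) ≠ 0 → (S : Matrix (Fin 2) (Fin 2) L).det = 0 → (S : Matrix (Fin 2) (Fin 2) L) = Matrix.vecMulVec (u S) (w S) ∧
        (∀ k : Fin 2, ((gramR L e dV hdV dW hdW).map (algebraMap (Fp L) L)) k k * (S : Matrix (Fin 2) (Fin 2) L) k k =
          IsCMField.complexConj L (((γ (Projectivization.mk L (w S) (hw S)) : GL (Fin 2) L) : Matrix (Fin 2) (Fin 2) L) 1 k) *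
            ((gramR L e dV hdV dW hdW).map (algebraMap (Fp L) L)) 1 1 * σc S * ((γ (Projectivization.mk L (w S) (hw S)) : GL (Fin 2) L) : Matrix (Fin 2) (Fin 2) L) 1 k) ∧
        gramR L e dV hdV dW hdW 1 1 * Algebra.trace (Fp L) L (σc S * imagUnit L) ≠ 0)
    -- the ARCH-CONT per-place variables (corner size `tw`, Gaussian parameter `pw`, entry bound `Rw`), the size `Pw`, the half-space imaginary parts `V`, BY VALUE
    (tw : skewMatrices ((IsCMField.complexConj L : L ≃ₐ[Fp L] L) : L →+* L) ((gramR L e dV hdV dW hdW).map (algebraMap (Fp L) L)) → InfinitePlace L → ℝ)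
    (pw Rw Pw : skewMatrices ((IsCMField.complexConj L : L ≃ₐ[Fp L] L) : L →+* L) ((gramR L e dV hdV dW hdW).map (algebraMap (Fp L) L)) → HA L e dV hdV dW hdW → InfinitePlace L → ℝ)
    (V : InfinitePlace L → HA L e dV hdV dW hdW → Matrix (Fin 2) (Fin 2) ℂ) (κ : InfinitePlace L → ℝ) (hκ : ∀ w', 0 < κ w')
    {cp cV aV CP bP CR : ℝ} {aR : ℕ} (hcp : 0 < cp) (hcV : 0 < cV) (haV : 0 ≤ aV) (hCP : 0 ≤ CP) (hbP : 0 ≤ bP) (hCR : 0 ≤ CR)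
    -- (a=) the corner-index reading as an EQUALITY; (b) the lower translate reading and (c) the λ_min floor (★ p864639's letters VERBATIM); (b↑) the upper reading; (r)
    (htw_eq : ∀ X : skewMatrices ((IsCMField.complexConj L : L ≃ₐ[Fp L] L) : L →+* L) ((gramR L e dV hdV dW hdW).map (algebraMap (Fp L) L)),
      (X : Matrix (Fin 2) (Fin 2) L) ≠ 0 → (X : Matrix (Fin 2) (Fin 2) L).det = 0 → ∀ w' ∈ Tinf, tw X w' = κ w' * w' (σc X))
    (hpw : ∀ (X : skewMatrices ((IsCMField.complexConj L : L ≃ₐ[Fp L] L) : L →+* L) ((gramR L e dV hdV dW hdW).map (algebraMap (Fp L) L))) (h : HA L e dV hdV dW hdW),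
      (X : Matrix (Fin 2) (Fin 2) L) ≠ 0 → (X : Matrix (Fin 2) (Fin 2) L).det = 0 → ∀ w' ∈ Tinf,
        cp * (star (fun k => w'.embedding (((γ (Projectivization.mk L (w X) (hw X)) : GL (Fin 2) L) : Matrix (Fin 2) (Fin 2) L) 1 k)) ⬝ᵥ
          (V w' h *ᵥ fun k => w'.embedding (((γ (Projectivization.mk L (w X) (hw X)) : GL (Fin 2) L) : Matrix (Fin 2) (Fin 2) L) 1 k))).re ≤ pw X h w')
    (hV : ∀ (h : HA L e dV hdV dW hdW), ∀ w' ∈ Tinf, ∀ v : Fin 2 → ℂ,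
      cV * adelicHeightGL (2 + 2) L (h : GL (Fin (2 + 2)) (AdeleRing (𝓞 L) L)) ^ (-aV) * ∑ k, ‖v k‖ ^ 2 ≤ (star v ⬝ᵥ (V w' h *ᵥ v)).re)
    (hpw_le : ∀ (X : skewMatrices ((IsCMField.complexConj L : L ≃ₐ[Fp L] L) : L →+* L) ((gramR L e dV hdV dW hdW).map (algebraMap (Fp L) L))) (h : HA L e dV hdV dW hdW),
      (X : Matrix (Fin 2) (Fin 2) L) ≠ 0 → (X : Matrix (Fin 2) (Fin 2) L).det = 0 → ∀ w' ∈ Tinf,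
        pw X h w' ≤ CP * adelicHeightGL (2 + 2) L (h : GL (Fin (2 + 2)) (AdeleRing (𝓞 L) L)) ^ bP *
          ∑ k, ‖w'.embedding (((γ (Projectivization.mk L (w X) (hw X)) : GL (Fin 2) L) : Matrix (Fin 2) (Fin 2) L) 1 k)‖ ^ 2)
    (hRw : ∀ (X : skewMatrices ((IsCMField.complexConj L : L ≃ₐ[Fp L] L) : L →+* L) ((gramR L e dV hdV dW hdW).map (algebraMap (Fp L) L))) (h : HA L e dV hdV dW hdW),
      (X : Matrix (Fin 2) (Fin 2) L) ≠ 0 → (X : Matrix (Fin 2) (Fin 2) L).det = 0 → ∀ w' ∈ Tinf,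
        0 ≤ Rw X h w' ∧ Rw X h w' ≤ CR * adelicHeightGL (2 + 2) L ((gc X * h : HA L e dV hdV dW hdW) : GL (Fin (2 + 2)) (AdeleRing (𝓞 L) L)) ^ aR)
    -- ★ p864498's `hP1` and the (Sz) shape letter ((G-b)'s polynomial factor)
    (hP1 : ∀ (X : skewMatrices ((IsCMField.complexConj L : L ≃ₐ[Fp L] L) : L →+* L) ((gramR L e dV hdV dW hdW).map (algebraMap (Fp L) L))) (h : HA L e dV hdV dW hdW),
      (X : Matrix (Fin 2) (Fin 2) L) ≠ 0 → (X : Matrix (Fin 2) (Fin 2) L).det = 0 → ∀ w ∈ Tinf, 1 ≤ Pw X h w)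
    (hPw : ∀ (X : skewMatrices ((IsCMField.complexConj L : L ≃ₐ[Fp L] L) : L →+* L) ((gramR L e dV hdV dW hdW).map (algebraMap (Fp L) L))) (h : HA L e dV hdV dW hdW),
      (X : Matrix (Fin 2) (Fin 2) L) ≠ 0 → (X : Matrix (Fin 2) (Fin 2) L).det = 0 → ∀ w' ∈ Tinf,
        Pw X h w' ≤ (((1 + pw X h w') * (1 + (pw X h w')⁻¹)) * ((1 + tw X w') * (1 + (tw X w')⁻¹))) * (1 + Rw X h w'))
    -- the archimedean size
    (τa : skewMatrices ((IsCMField.complexConj L : L ≃ₐ[Fp L] L) : L →+* L) ((gramR L e dV hdV dW hdW).map (algebraMap (Fp L) L)) → ℝ)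
    (hτa : ∀ X : skewMatrices ((IsCMField.complexConj L : L ≃ₐ[Fp L] L) : L →+* L) ((gramR L e dV hdV dW hdW).map (algebraMap (Fp L) L)),
      ‖(fun i j => NumberField.mixedEmbedding L ((X : Matrix (Fin 2) (Fin 2) L) i j))‖ ≤ τa X) :
    ∃ (N₁' Nd₁' : ℕ) (C₁ a₁ : ℝ), 0 ≤ C₁ ∧ 0 ≤ a₁ ∧
      ∀ (X : skewMatrices ((IsCMField.complexConj L : L ≃ₐ[Fp L] L) : L →+* L) ((gramR L e dV hdV dW hdW).map (algebraMap (Fp L) L))) (h : HA L e dV hdV dW hdW),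
        (X : Matrix (Fin 2) (Fin 2) L) ≠ 0 → (X : Matrix (Fin 2) (Fin 2) L).det = 0 → ∀ d : ℕ, 1 ≤ d →
        (∀ i j, IsIntegral ℤ ((d : L) * (X : Matrix (Fin 2) (Fin 2) L) i j)) →
          ∏ w ∈ Tinf, Pw X h w ≤ C₁ * adelicHeightGL (2 + 2) L (h : GL (Fin (2 + 2)) (AdeleRing (𝓞 L) L)) ^ a₁ * (1 + τa X) ^ N₁' * (d : ℝ) ^ Nd₁' := by
  obtain rfl : Tinf = Finset.univ := Finset.eq_univ_iff_forall.2 hall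
  -- the constants of the datum: (C-d-i) the corner-scalar denominator `d₀`; the height bricks (B-i)(B-ii)(B-iii) with the clause `‖Λ(γ[w'])‖ ≤ B₀·H(w')^{2k₁}` for the
  -- GIVEN normalised `γ` (as ★ p864306), packaged by ★ `exists_leviRow_translate_height_le`; the height floor `m`
  obtain ⟨d₀, hd₀, hden⟩ := K2LiuCornerScalarPoleCount.exists_cornerScalar_den_pole_count L e dV hdV dW hdW hdV0 hdW0
  obtain ⟨B₁, k₁, hB₁, hBi⟩ := K2LiuVecHeightVsMulHeight.exists_vecHeight_principalVec_le_mulHeight_pow (K := L) (ι := Fin 2)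
  obtain ⟨B₂, hB₂, hBii⟩ := K2LiuRowSectionHeightLeVecHeight.exists_adelicHeightGL_rowSection_le L
  obtain ⟨B₃, hB₃, hBiii⟩ := K2LiuLeviHomHeightBound.exists_adelicHeightGL_leviHom_le_sq L e dV hdV dW hdW hdV0 hdW0 Λ hΛ
  have hclause : ∀ (w' : Fin 2 → L) (hw' : w' ≠ 0),
      adelicHeightGL (2 + 2) L ((fun g : GL (Fin 2) (AdeleRing (𝓞 L) L) => ((Λ g : HA L e dV hdV dW hdW) : GL (Fin (2 + 2)) (AdeleRing (𝓞 L) L)))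
        (Matrix.GeneralLinearGroup.map (algebraMap L (AdeleRing (𝓞 L) L)) (γ (Projectivization.mk L w' hw')))) ≤ (B₃ * (B₂ * B₁) ^ 2) * Height.mulHeight w' ^ (2 * k₁) := by
    intro w' hw'
    obtain ⟨i, hi, -, hent⟩ := hnorm w' hw'
    have h12 : adelicHeightGL 2 L (Matrix.GeneralLinearGroup.map (algebraMap L (AdeleRing (𝓞 L) L)) (γ (Projectivization.mk L w' hw'))) ≤ B₂ * B₁ * Height.mulHeight w' ^ k₁ :=
      calc adelicHeightGL 2 L (Matrix.GeneralLinearGroup.map (algebraMap L (AdeleRing (𝓞 L) L)) (γ (Projectivization.mk L w' hw')))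
          ≤ B₂ * ((vecHeight L (principalVec L w') : ℝ≥0) : ℝ) := hBii w' i hi _ hent
        _ ≤ B₂ * (B₁ * Height.mulHeight w' ^ k₁) := mul_le_mul_of_nonneg_left (hBi w' hw') hB₂
        _ = B₂ * B₁ * Height.mulHeight w' ^ k₁ := by ring
    have h0 : 0 ≤ adelicHeightGL 2 L (Matrix.GeneralLinearGroup.map (algebraMap L (AdeleRing (𝓞 L) L)) (γ (Projectivization.mk L w' hw'))) := adelicHeightGL_nonneg _
    calc adelicHeightGL (2 + 2) L ((Λ (Matrix.GeneralLinearGroup.map (algebraMap L (AdeleRing (𝓞 L) L)) (γ (Projectivization.mk L w' hw'))) : HA L e dV hdV dW hdW) :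
            GL (Fin (2 + 2)) (AdeleRing (𝓞 L) L))
        ≤ B₃ * adelicHeightGL 2 L (Matrix.GeneralLinearGroup.map (algebraMap L (AdeleRing (𝓞 L) L)) (γ (Projectivization.mk L w' hw'))) ^ 2 := hBiii _
      _ ≤ B₃ * (B₂ * B₁ * Height.mulHeight w' ^ k₁) ^ 2 := mul_le_mul_of_nonneg_left (pow_le_pow_left₀ h0 h12 2) hB₃
      _ = (B₃ * (B₂ * B₁) ^ 2) * Height.mulHeight w' ^ (2 * k₁) := by ring
  obtain ⟨Ctr, ktr, ktr', hCtr, htr⟩ := K2LiuKindOneLineTranslateHeight.exists_leviRow_translate_height_le L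
    (fun g : GL (Fin 2) (AdeleRing (𝓞 L) L) => ((Λ g : HA L e dV hdV dW hdW) : GL (Fin (2 + 2)) (AdeleRing (𝓞 L) L))) γ ⟨B₃ * (B₂ * B₁) ^ 2, 2 * k₁, by positivity, hclause⟩
  haveI : NeZero (2 + 2) := ⟨by norm_num⟩
  obtain ⟨m, hm, hmle⟩ := K2LiuWhittakerWeightedGrowthInstance.exists_pos_le_adelicHeightGL (n := 2 + 2) (K := L)
  -- the Gram scalars `t_k = T_L k k ≠ 0` and the ratio constant `Kt ≥ w'(t_a)/w'(t₁)`
  have hTL0 : ∀ k : Fin 2, ((gramR L e dV hdV dW hdW).map (algebraMap (Fp L) L)) k k ≠ 0 := fun k =>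
    K2LiuRankOneIndexValueTwoCorner.gramRL_apply_same_ne_zero L e dV hdV hdV0 dW hdW hdW0 k
  obtain ⟨Kt, hKt0, hKtle⟩ : ∃ Kt : ℝ, 0 ≤ Kt ∧ ∀ (w' : InfinitePlace L) (a : Fin 2),
      w' (((gramR L e dV hdV dW hdW).map (algebraMap (Fp L) L)) a a) / w' (((gramR L e dV hdV dW hdW).map (algebraMap (Fp L) L)) 1 1) ≤ Kt := by
    refine ⟨∑ w' : InfinitePlace L, ∑ a : Fin 2, w' (((gramR L e dV hdV dW hdW).map (algebraMap (Fp L) L)) a a) / w' (((gramR L e dV hdV dW hdW).map (algebraMap (Fp L) L)) 1 1),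
      Finset.sum_nonneg fun w' _ => Finset.sum_nonneg fun a _ => div_nonneg (apply_nonneg _ _) (apply_nonneg _ _), fun w' a => ?_⟩
    exact (Finset.single_le_sum (f := fun a : Fin 2 => w' (((gramR L e dV hdV dW hdW).map (algebraMap (Fp L) L)) a a) / w' (((gramR L e dV hdV dW hdW).map (algebraMap (Fp L) L)) 1 1))
        (fun b _ => div_nonneg (apply_nonneg _ _) (apply_nonneg _ _)) (Finset.mem_univ a)).trans
      (Finset.single_le_sum (f := fun w'' : InfinitePlace L => ∑ a : Fin 2, w'' (((gramR L e dV hdV dW hdW).map (algebraMap (Fp L) L)) a a) / w'' (((gramR L e dV hdV dW hdW).map (algebraMap (Fp L) L)) 1 1))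
        (fun w'' _ => Finset.sum_nonneg fun b _ => div_nonneg (apply_nonneg _ _) (apply_nonneg _ _)) (Finset.mem_univ w'))
  have hCκ0 : 0 ≤ ∏ w' : InfinitePlace L, (1 + κ w' * Kt) := Finset.prod_nonneg fun w' _ => by have := mul_nonneg (hκ w').le hKt0; linarith
  have hκi0 : 0 ≤ ∏ w' : InfinitePlace L, (κ w')⁻¹ := Finset.prod_nonneg fun w' _ => (inv_pos.2 (hκ w')).le
  refine ⟨Module.finrank ℚ L + Fintype.card (InfinitePlace L) + Fintype.card (InfinitePlace L) + ktr * aR * Fintype.card (InfinitePlace L),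
    Module.finrank ℚ L + Module.finrank ℚ L + ktr * aR * Fintype.card (InfinitePlace L),
    ((m⁻¹ ^ bP + CP) ^ Fintype.card (InfinitePlace L) * (2 : ℝ) ^ Fintype.card (InfinitePlace L)) * (m⁻¹ ^ aV + (cp * cV)⁻¹) ^ Fintype.card (InfinitePlace L) *
      ((∏ w' : InfinitePlace L, (1 + κ w' * Kt)) * (∏ w' : InfinitePlace L, (1 + κ w' * Kt)) * ∏ w' : InfinitePlace L, (κ w')⁻¹) * (d₀ : ℝ) ^ Module.finrank ℚ L *
      (m⁻¹ ^ (ktr' * aR) + CR * Ctr ^ aR) ^ Fintype.card (InfinitePlace L),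
    (bP + aV + ((ktr' * aR : ℕ) : ℝ)) * (Fintype.card (InfinitePlace L) : ℝ),
    mul_nonneg (mul_nonneg (mul_nonneg (mul_nonneg (by positivity) (by positivity)) (mul_nonneg (mul_nonneg hCκ0 hCκ0) hκi0)) (by positivity)) (by positivity),
    by positivity, fun X h hX0 hdet D hD hDX => ?_⟩
  -- the objects of record for this `(X, h, D)`; the pivot: `t_i · X_ii = t₁ · σc X`, so `σc X ≠ 0` and `(D d₀)·σc X` is `ℤ`-integral
  obtain ⟨hS1, hdiag, hτr⟩ := hpres X hX0 hdet
  obtain ⟨i, hi, hrow, -⟩ := hnorm (w X) (hw X)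
  have hD0 : D ≠ 0 := by omega
  have hDd0 : D * d₀ ≠ 0 := mul_ne_zero hD0 hd₀
  set g : Matrix (Fin 2) (Fin 2) L := ((γ (Projectivization.mk L (w X) (hw X)) : GL (Fin 2) L) : Matrix (Fin 2) (Fin 2) L) with hgdef
  have hg1 : ∀ k, g 1 k = (w X i)⁻¹ * w X k := fun k => by rw [hrow, Pi.smul_apply, smul_eq_mul]
  have h1i : g 1 i = 1 := by rw [hg1, inv_mul_cancel₀ hi]
  have hpiv : ((gramR L e dV hdV dW hdW).map (algebraMap (Fp L) L)) i i * (X : Matrix (Fin 2) (Fin 2) L) i i = ((gramR L e dV hdV dW hdW).map (algebraMap (Fp L) L)) 1 1 * σc X := by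
    rw [hdiag i, h1i, map_one, one_mul, mul_one]
  have hσ0 : σc X ≠ 0 := fun h0 => hτr (by rw [h0, zero_mul, map_zero, mul_zero])
  obtain ⟨hσint, -⟩ := hden (σc X) ((X : Matrix (Fin 2) (Fin 2) L) i i) i D hD0 (hDX i i) hpiv
  -- sizes: the height `H ≥ m`, the archimedean size `τa X ≥ ‖ι_∞ X‖`, `D(1+τa X) ≥ 1`
  set H : ℝ := adelicHeightGL (2 + 2) L (h : GL (Fin (2 + 2)) (AdeleRing (𝓞 L) L)) with hHdef
  have hmH : m ≤ H := hmle _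
  have hH0 : 0 < H := hm.trans_le hmH
  have hτX : ‖(fun a b => NumberField.mixedEmbedding L ((X : Matrix (Fin 2) (Fin 2) L) a b))‖ ≤ τa X := hτa X
  have hτ0 : 0 ≤ τa X := (norm_nonneg _).trans hτX
  have hD1 : (1 : ℝ) ≤ D := by exact_mod_cast hD
  have hQ1 : 1 ≤ ((D : ℝ) * (1 + τa X)) ^ ktr := one_le_pow₀ (one_le_mul_of_one_le_of_one_le hD1 (by linarith))
  -- the translate chain `‖gc X·h‖ ≤ Ctr·(D(1+τ))^{ktr}·H^{ktr'}`
  have hS' : Matrix.vecMulVec (u X) (w X) ≠ 0 := hS1 ▸ hX0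
  have hint' : ∀ a b, IsIntegral ℤ ((D : L) * Matrix.vecMulVec (u X) (w X) a b) := fun a b => by rw [← hS1]; exact hDX a b
  have hτ' : ‖(fun a b => NumberField.mixedEmbedding L (Matrix.vecMulVec (u X) (w X) a b))‖ ≤ τa X := by rw [← hS1]; exact hτa X
  have hgh : ((gc X * h : HA L e dV hdV dW hdW) : GL (Fin (2 + 2)) (AdeleRing (𝓞 L) L)) =
      ((Λ (Matrix.GeneralLinearGroup.map (algebraMap L (AdeleRing (𝓞 L) L)) (γ (Projectivization.mk L (w X) (hw X)))) : HA L e dV hdV dW hdW) :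
        GL (Fin (2 + 2)) (AdeleRing (𝓞 L) L)) * (h : GL (Fin (2 + 2)) (AdeleRing (𝓞 L) L)) := by
    rw [hgc X]; rfl
  have hB0 : 0 ≤ adelicHeightGL (2 + 2) L ((gc X * h : HA L e dV hdV dW hdW) : GL (Fin (2 + 2)) (AdeleRing (𝓞 L) L)) := adelicHeightGL_nonneg _
  have hB : adelicHeightGL (2 + 2) L ((gc X * h : HA L e dV hdV dW hdW) : GL (Fin (2 + 2)) (AdeleRing (𝓞 L) L)) ≤ Ctr * ((D : ℝ) * (1 + τa X)) ^ ktr * H ^ ktr' := by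
    rw [hgh]
    refine (htr (u X) (w X) (hw X) hS' D hD hint' (h : GL (Fin (2 + 2)) (AdeleRing (𝓞 L) L))).trans ?_
    have h1τ : (D : ℝ) * (1 + ‖(fun a b => NumberField.mixedEmbedding L (Matrix.vecMulVec (u X) (w X) a b))‖) ≤ (D : ℝ) * (1 + τa X) :=
      mul_le_mul_of_nonneg_left (by linarith) (Nat.cast_nonneg D)
    exact mul_le_mul_of_nonneg_right (mul_le_mul_of_nonneg_left (pow_le_pow_left₀ (by positivity) h1τ _) hCtr) (pow_nonneg hH0.le _)
  -- the corner size from above: `w'(σc X) = (w'(t_i)/w'(t₁))·w'(X_ii) ≤ Kt · τa X`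
  have hXii : ∀ w' : InfinitePlace L, w' ((X : Matrix (Fin 2) (Fin 2) L) i i) ≤ τa X := fun w' =>
    calc w' ((X : Matrix (Fin 2) (Fin 2) L) i i) = NumberField.mixedEmbedding.normAtPlace w' (NumberField.mixedEmbedding L ((X : Matrix (Fin 2) (Fin 2) L) i i)) :=
          (NumberField.mixedEmbedding.normAtPlace_apply w' _).symm
      _ ≤ ‖NumberField.mixedEmbedding L ((X : Matrix (Fin 2) (Fin 2) L) i i)‖ := by
          rw [NumberField.mixedEmbedding.norm_eq_sup'_normAtPlace]
          exact Finset.le_sup' (fun w'' => NumberField.mixedEmbedding.normAtPlace w'' (NumberField.mixedEmbedding L ((X : Matrix (Fin 2) (Fin 2) L) i i))) (Finset.mem_univ w')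
      _ ≤ ‖fun b => NumberField.mixedEmbedding L ((X : Matrix (Fin 2) (Fin 2) L) i b)‖ := norm_le_pi_norm (fun b => NumberField.mixedEmbedding L ((X : Matrix (Fin 2) (Fin 2) L) i b)) i
      _ ≤ ‖fun a b => NumberField.mixedEmbedding L ((X : Matrix (Fin 2) (Fin 2) L) a b)‖ := norm_le_pi_norm (fun a b => NumberField.mixedEmbedding L ((X : Matrix (Fin 2) (Fin 2) L) a b)) i
      _ ≤ τa X := hτX
  have hσle : ∀ w' : InfinitePlace L, w' (σc X) ≤ Kt * τa X := by
    intro w'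
    have ht1 : 0 < w' (((gramR L e dV hdV dW hdW).map (algebraMap (Fp L) L)) 1 1) := InfinitePlace.pos_iff.2 (hTL0 1)
    have h2 : w' (((gramR L e dV hdV dW hdW).map (algebraMap (Fp L) L)) i i * (X : Matrix (Fin 2) (Fin 2) L) i i) =
        w' (((gramR L e dV hdV dW hdW).map (algebraMap (Fp L) L)) 1 1 * σc X) := by rw [hpiv]
    rw [map_mul, map_mul] at h2
    have heq : w' (σc X) = w' (((gramR L e dV hdV dW hdW).map (algebraMap (Fp L) L)) i i) / w' (((gramR L e dV hdV dW hdW).map (algebraMap (Fp L) L)) 1 1) *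
        w' ((X : Matrix (Fin 2) (Fin 2) L) i i) := by rw [div_mul_eq_mul_div, eq_div_iff ht1.ne', h2, mul_comm]
    rw [heq]
    exact mul_le_mul (hKtle w' i) (hXii w') (apply_nonneg _ _) hKt0
  -- PER PLACE: `Pw ≤ Sz ≤ F₁ F₂ F₃ F₄ F₅` (★ `sizeFactor_le` on the six reading letters)
  have hplace : ∀ w' ∈ (Finset.univ : Finset (InfinitePlace L)), Pw X h w' ≤
      ((((m⁻¹ ^ bP + CP) * H ^ bP * ∑ k, ‖w'.embedding (g 1 k)‖ ^ 2) * ((m⁻¹ ^ aV + (cp * cV)⁻¹) * H ^ aV)) *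
        (((1 + κ w' * Kt) * (1 + τa X)) * (((1 + κ w' * Kt) * (1 + τa X)) * ((κ w')⁻¹ * (w' (σc X))⁻¹)))) *
      ((m⁻¹ ^ (ktr' * aR) + CR * Ctr ^ aR) * (((D : ℝ) * (1 + τa X)) ^ ktr) ^ aR * H ^ (ktr' * aR)) := by
    intro w' hw'
    have hS1' : 1 ≤ ∑ k, ‖w'.embedding (g 1 k)‖ ^ 2 := by
      have hle := Finset.single_le_sum (f := fun k : Fin 2 => ‖w'.embedding (g 1 k)‖ ^ 2) (fun k _ => sq_nonneg _) (Finset.mem_univ i)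
      simp only [h1i, map_one, norm_one, one_pow] at hle
      exact hle
    have hlo := hV h w' hw' (fun k => w'.embedding (g 1 k))
    obtain ⟨hR0, hRb⟩ := hRw X h hX0 hdet w' hw'
    exact (hPw X h hX0 hdet w' hw').trans
      (sizeFactor_le hm hmH hS1' hcp hcV haV hbP ((mul_le_mul_of_nonneg_left hlo hcp.le).trans (hpw X h hX0 hdet w' hw')) (hpw_le X h hX0 hdet w' hw')
        (hκ w') (InfinitePlace.pos_iff.2 hσ0) (htw_eq X hX0 hdet w' hw') hKt0 hτ0 (hσle w') hR0 hCR hRb hB0 hQ1 hB)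
  -- THE TWO GLOBAL PRODUCT LETTERS (★ (v-α)): `∏_w S_w ≤ 2^{#w}(D(1+τ))^{[L:ℚ]}`, `∏_w w(σc X)⁻¹ ≤ (D d₀)^{[L:ℚ]}`
  have hSprod : ∏ w' : InfinitePlace L, (∑ k, ‖w'.embedding (g 1 k)‖ ^ 2) ≤ (2 : ℝ) ^ Fintype.card (InfinitePlace L) * ((D : ℝ) * (1 + τa X)) ^ Module.finrank ℚ L :=
    calc ∏ w' : InfinitePlace L, (∑ k, ‖w'.embedding (g 1 k)‖ ^ 2) = ∏ w' : InfinitePlace L, (∑ k, ‖w'.embedding ((w X i)⁻¹ * w X k)‖ ^ 2) := by simp only [hg1]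
      _ ≤ (2 : ℝ) ^ Fintype.card (InfinitePlace L) * ((D : ℝ) * (1 + ‖fun a b => NumberField.mixedEmbedding L (Matrix.vecMulVec (u X) (w X) a b)‖)) ^ Module.finrank ℚ L :=
          prod_sum_sq_normalisedRow_le L (u X) (w X) hS' hD hint' hi
      _ ≤ (2 : ℝ) ^ Fintype.card (InfinitePlace L) * ((D : ℝ) * (1 + τa X)) ^ Module.finrank ℚ L :=
          mul_le_mul_of_nonneg_left (pow_le_pow_left₀ (by positivity) (mul_le_mul_of_nonneg_left (by linarith) (Nat.cast_nonneg D)) _) (by positivity)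
  have hσprod : ∏ w' : InfinitePlace L, (w' (σc X))⁻¹ ≤ ((D : ℝ) * d₀) ^ Module.finrank ℚ L := by
    have hprod := prod_inv_apply_le_pow_of_isIntegral L (σc X) hσ0 hDd0 hσint
    push_cast at hprod
    exact hprod
  -- the product of the per-place bounds, regrouped as `K₀ · (∏_w S_w · ∏_w w(σc X)⁻¹)`, and the height exponent regrouped
  have hK₀ : 0 ≤ (m⁻¹ ^ bP + CP) ^ Fintype.card (InfinitePlace L) * (H ^ bP) ^ Fintype.card (InfinitePlace L) *
      ((m⁻¹ ^ aV + (cp * cV)⁻¹) ^ Fintype.card (InfinitePlace L) * (H ^ aV) ^ Fintype.card (InfinitePlace L)) *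
      (((∏ w' : InfinitePlace L, (1 + κ w' * Kt)) * (1 + τa X) ^ Fintype.card (InfinitePlace L)) *
        (((∏ w' : InfinitePlace L, (1 + κ w' * Kt)) * (1 + τa X) ^ Fintype.card (InfinitePlace L)) * ∏ w' : InfinitePlace L, (κ w')⁻¹)) *
      ((m⁻¹ ^ (ktr' * aR) + CR * Ctr ^ aR) ^ Fintype.card (InfinitePlace L) * ((((D : ℝ) * (1 + τa X)) ^ ktr) ^ aR) ^ Fintype.card (InfinitePlace L) *
        (H ^ (ktr' * aR)) ^ Fintype.card (InfinitePlace L)) :=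
    mul_nonneg (mul_nonneg (by positivity) (mul_nonneg (mul_nonneg hCκ0 (by positivity)) (mul_nonneg (mul_nonneg hCκ0 (by positivity)) hκi0))) (by positivity)
  have hregroup : ∏ w' : InfinitePlace L,
      (((((m⁻¹ ^ bP + CP) * H ^ bP * ∑ k, ‖w'.embedding (g 1 k)‖ ^ 2) * ((m⁻¹ ^ aV + (cp * cV)⁻¹) * H ^ aV)) *
        (((1 + κ w' * Kt) * (1 + τa X)) * (((1 + κ w' * Kt) * (1 + τa X)) * ((κ w')⁻¹ * (w' (σc X))⁻¹)))) *
      ((m⁻¹ ^ (ktr' * aR) + CR * Ctr ^ aR) * (((D : ℝ) * (1 + τa X)) ^ ktr) ^ aR * H ^ (ktr' * aR))) =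
      ((m⁻¹ ^ bP + CP) ^ Fintype.card (InfinitePlace L) * (H ^ bP) ^ Fintype.card (InfinitePlace L) *
        ((m⁻¹ ^ aV + (cp * cV)⁻¹) ^ Fintype.card (InfinitePlace L) * (H ^ aV) ^ Fintype.card (InfinitePlace L)) *
        (((∏ w' : InfinitePlace L, (1 + κ w' * Kt)) * (1 + τa X) ^ Fintype.card (InfinitePlace L)) *
          (((∏ w' : InfinitePlace L, (1 + κ w' * Kt)) * (1 + τa X) ^ Fintype.card (InfinitePlace L)) * ∏ w' : InfinitePlace L, (κ w')⁻¹)) *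
        ((m⁻¹ ^ (ktr' * aR) + CR * Ctr ^ aR) ^ Fintype.card (InfinitePlace L) * ((((D : ℝ) * (1 + τa X)) ^ ktr) ^ aR) ^ Fintype.card (InfinitePlace L) *
          (H ^ (ktr' * aR)) ^ Fintype.card (InfinitePlace L))) *
      ((∏ w' : InfinitePlace L, (∑ k, ‖w'.embedding (g 1 k)‖ ^ 2)) * ∏ w' : InfinitePlace L, (w' (σc X))⁻¹) := by
    simp only [Finset.prod_mul_distrib, Finset.prod_const, Finset.card_univ]
    ring
  have hHa : H ^ ((bP + aV + ((ktr' * aR : ℕ) : ℝ)) * (Fintype.card (InfinitePlace L) : ℝ)) =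
      (H ^ bP) ^ Fintype.card (InfinitePlace L) * (H ^ aV) ^ Fintype.card (InfinitePlace L) * (H ^ (ktr' * aR)) ^ Fintype.card (InfinitePlace L) := by
    rw [add_mul, add_mul, Real.rpow_add hH0, Real.rpow_add hH0, Real.rpow_mul_natCast hH0.le, Real.rpow_mul_natCast hH0.le, Real.rpow_mul_natCast hH0.le, Real.rpow_natCast]
  calc ∏ w' : InfinitePlace L, Pw X h w'
      ≤ ∏ w' : InfinitePlace L,
          (((((m⁻¹ ^ bP + CP) * H ^ bP * ∑ k, ‖w'.embedding (g 1 k)‖ ^ 2) * ((m⁻¹ ^ aV + (cp * cV)⁻¹) * H ^ aV)) *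
            (((1 + κ w' * Kt) * (1 + τa X)) * (((1 + κ w' * Kt) * (1 + τa X)) * ((κ w')⁻¹ * (w' (σc X))⁻¹)))) *
          ((m⁻¹ ^ (ktr' * aR) + CR * Ctr ^ aR) * (((D : ℝ) * (1 + τa X)) ^ ktr) ^ aR * H ^ (ktr' * aR))) :=
        Finset.prod_le_prod (fun w' hw' => zero_le_one.trans (hP1 X h hX0 hdet w' hw')) hplace
    _ = _ := hregroup
    _ ≤ ((m⁻¹ ^ bP + CP) ^ Fintype.card (InfinitePlace L) * (H ^ bP) ^ Fintype.card (InfinitePlace L) *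
          ((m⁻¹ ^ aV + (cp * cV)⁻¹) ^ Fintype.card (InfinitePlace L) * (H ^ aV) ^ Fintype.card (InfinitePlace L)) *
          (((∏ w' : InfinitePlace L, (1 + κ w' * Kt)) * (1 + τa X) ^ Fintype.card (InfinitePlace L)) *
            (((∏ w' : InfinitePlace L, (1 + κ w' * Kt)) * (1 + τa X) ^ Fintype.card (InfinitePlace L)) * ∏ w' : InfinitePlace L, (κ w')⁻¹)) *
          ((m⁻¹ ^ (ktr' * aR) + CR * Ctr ^ aR) ^ Fintype.card (InfinitePlace L) * ((((D : ℝ) * (1 + τa X)) ^ ktr) ^ aR) ^ Fintype.card (InfinitePlace L) *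
            (H ^ (ktr' * aR)) ^ Fintype.card (InfinitePlace L))) *
        (((2 : ℝ) ^ Fintype.card (InfinitePlace L) * ((D : ℝ) * (1 + τa X)) ^ Module.finrank ℚ L) * ((D : ℝ) * d₀) ^ Module.finrank ℚ L) :=
        mul_le_mul_of_nonneg_left (mul_le_mul hSprod hσprod (Finset.prod_nonneg fun w' _ => inv_nonneg.2 (apply_nonneg _ _)) (by positivity)) hK₀
    _ = ((m⁻¹ ^ bP + CP) ^ Fintype.card (InfinitePlace L) * (2 : ℝ) ^ Fintype.card (InfinitePlace L)) * (m⁻¹ ^ aV + (cp * cV)⁻¹) ^ Fintype.card (InfinitePlace L) *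
          ((∏ w' : InfinitePlace L, (1 + κ w' * Kt)) * (∏ w' : InfinitePlace L, (1 + κ w' * Kt)) * ∏ w' : InfinitePlace L, (κ w')⁻¹) * (d₀ : ℝ) ^ Module.finrank ℚ L *
          (m⁻¹ ^ (ktr' * aR) + CR * Ctr ^ aR) ^ Fintype.card (InfinitePlace L) *
        H ^ ((bP + aV + ((ktr' * aR : ℕ) : ℝ)) * (Fintype.card (InfinitePlace L) : ℝ)) *
        (1 + τa X) ^ (Module.finrank ℚ L + Fintype.card (InfinitePlace L) + Fintype.card (InfinitePlace L) + ktr * aR * Fintype.card (InfinitePlace L)) *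
        (D : ℝ) ^ (Module.finrank ℚ L + Module.finrank ℚ L + ktr * aR * Fintype.card (InfinitePlace L)) := by
        rw [hHa]
        simp only [mul_pow, pow_add, pow_mul]
        ring

end Dictionary

end Summit.HodgeConjecture.HodgeConjecture.Cruxes.HLiu418.K2LiuKindOneSingularPrefactorDictionary

end
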